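import Mathlib
import HarnessLib
import Literature.Computability.AlgebraicComplexity.KV20NonRigidEquationsProofs
import Summits.ValiantsHypothesis.ValiantsHypothesis.Theorems.SchenstedIndexPowTraceCertificateTools

/-!
# Route SchenstedIndex — an integral spanning set for `span_n(t,m)` (towards crux #2
# `OneFactorisationBandLimit`, stmt-ValiantsHypothesis-16081)

The crux `OneFactorisationBandLimit` (and its calibration rung `BorderPcPerThree`) asks whether the
1-factorisation indicator `1_OF(t,m)` lies in
`span_n(t,m) := span_ℂ { v_X : X ∈ ℂ^{S × S}, rank X ≤ n }`, `S = Fin t × Fin m × Fin m`,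
`v_X(π) = ∏_(B ∈ π) ∑_(q : Fin m ≃ B) ∏_i X (q i) (q (i+1))` — a span over an INFINITE family
indexed by a determinantal variety.  This file replaces it by the span of an explicit FINITE family
of ℕ-valued COUNT VECTORS (by-product noted on the crux idea card
`Cruxes/PowTraceCertificate/Ideas/slot-polarisation-imm-pullback.md`, §Transfer):

* `blockCycleVec_mul_eq_sum_smul` — ROW/COLUMN MULTILINEARITY: for `X = L · R` (`L : S × n`,
  `R : n × S`), `v_(L R) = ∑_(r : S → [n] × [n]) (∏_s L_(s, r₁ s) R_(r₂ s, s)) · v_(X_r)` with the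
  0/1 slot matrices `X_r(s, s') = [r₁ s = r₂ s']` (each block cycle uses every slot of its block
  exactly once as a row index and once as a column index; `blockCycle_mul_eq_sum`);
* `rank_slotIndicator_le` — `rank X_r ≤ n`;
* **`span_blockCycleVec_rank_le_eq_span_count`** — `span_n(t,m) = span_ℂ { v_(X_r) : r : S → [n]² }`
  (rank factorisation `KumarVolk2020.exists_mul_eq_of_rank_le` for `⊆`).
Consequently membership of ANY vector (in particular of `1_OF`) in `span_n(t,m)` is membership in
the ℂ-span of `n^(2|S|)` explicit integer vectors (`mem_span_rank_le_iff_mem_span_count`): crux #2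
is a statement of integer linear algebra, attackable exactly or modulo primes.

HONEST FRAMING: a reformulation of the OPEN crux `OneFactorisationBandLimit`; it decides nothing
and says nothing about `VP ≠ VNP`.  This module is ROUTE-INDEPENDENT (no import of the route file
`Theses/SchenstedIndex.lean`); the two `_iff_count` restatements of the route decls live in
`Theorems/SchenstedIndexCountVectorsCrux.lean`.
-/

set_option linter.dupNamespace false

noncomputable section

namespace Summit.ValiantsHypothesis.ValiantsHypothesis.Theorems.SchenstedIndex

open Matrix
open Literature.Computability.AlgebraicComplexity

/-! ## 1. One block: multilinear expansion of a block cycle of `L · R` -/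

/-- **One block cycle of a product `L · R` expands over row/column colourings**: for a bijection
`q : Fin m ≃ B`,
`∏_i (L R)_(q i, q (i+1)) = ∑_(r : B → [n]²) (∏_s L_(s, r₁ s) R_(r₂ s, s)) · ∏_i [r₁ (q i) = r₂ (q (i+1))]`:
the words `w : Fin m → [n]` of the expansion are exactly the bi-colourings `r` satisfying the cycle
condition, via `r₁ (q i) = w i = r₂ (q (i+1))`. -/
theorem prod_mul_apply_cycle_eq_sum {R : Type*} [CommRing R] {S : Type*} {m n : ℕ}
    {B : Type*} [Fintype B] [DecidableEq B]
    (L : Matrix S (Fin n) R) (Rm : Matrix (Fin n) S R) (emb : B → S) (q : Fin m ≃ B) :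
    ∏ i : Fin m, (L * Rm) (emb (q i)) (emb (q (finRotate m i))) =
      ∑ r : B → Fin n × Fin n, (∏ s : B, L (emb s) (r s).1 * Rm (r s).2 (emb s)) *
        ∏ i : Fin m, (if (r (q i)).1 = (r (q (finRotate m i))).2 then (1 : R) else 0) := by
  classical
  -- expand the product of sums over words `w : Fin m → Fin n`
  simp only [Matrix.mul_apply]
  rw [Fintype.prod_sum]
  -- the right-hand side is a sum over the bi-colourings satisfying the cycle condition
  have hrhs : ∀ r : B → Fin n × Fin n,
      (∏ s : B, L (emb s) (r s).1 * Rm (r s).2 (emb s)) *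
        (∏ i : Fin m, (if (r (q i)).1 = (r (q (finRotate m i))).2 then (1 : R) else 0)) =
      if (∀ i, (r (q i)).1 = (r (q (finRotate m i))).2)
        then ∏ s : B, L (emb s) (r s).1 * Rm (r s).2 (emb s) else 0 := by
    intro r
    rw [Finset.prod_boole]
    by_cases h : ∀ i, (r (q i)).1 = (r (q (finRotate m i))).2
    · rw [if_pos (fun i _ => h i), if_pos h, mul_one]
    · rw [if_neg (fun h' => h (fun i => h' i (Finset.mem_univ i))), if_neg h, mul_zero]
  simp_rw [hrhs]
  rw [← Finset.sum_filter]
  symm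
  refine Finset.sum_nbij' (fun r => fun i => (r (q i)).1)
    (fun w => fun s => (w (q.symm s), w ((finRotate m).symm (q.symm s)))) ?_ ?_ ?_ ?_ ?_
  · intro r _
    exact Finset.mem_univ _
  · intro w _
    refine Finset.mem_filter.2 ⟨Finset.mem_univ _, fun i => ?_⟩
    simp only [Equiv.symm_apply_apply]
  · intro r hr
    obtain ⟨-, hcond⟩ := Finset.mem_filter.1 hr
    funext s
    refine Prod.ext ?_ ?_
    · simp
    · have h := hcond ((finRotate m).symm (q.symm s))
      simp only [Equiv.apply_symm_apply] at h
      simpa using h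
  · intro w _
    funext i
    simp
  · intro r hr
    obtain ⟨-, hcond⟩ := Finset.mem_filter.1 hr
    rw [Finset.prod_mul_distrib, Finset.prod_mul_distrib]
    congr 1
    · exact (q.prod_comp (fun s => L (emb s) (r s).1)).symm
    · rw [← ((finRotate m).trans q).prod_comp (fun s => Rm (r s).2 (emb s))]
      refine Finset.prod_congr rfl fun i _ => ?_
      rw [Equiv.trans_apply, ← hcond i]

/-- **Block cycles of `L · R`**: summing over the bijections,
`∑_q ∏_i (L R)_(q i, q (i+1)) = ∑_(r : B → [n]²) (∏_s L_(s, r₁ s) R_(r₂ s, s)) · ∑_q ∏_i X_r(q i, q (i+1))`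
with the 0/1 slot matrix `X_r(s,s') = [r₁ s = r₂ s']`. -/
theorem blockCycle_mul_eq_sum {R : Type*} [CommRing R] {S : Type*} {m n : ℕ}
    {B : Type*} [Fintype B] [DecidableEq B]
    (L : Matrix S (Fin n) R) (Rm : Matrix (Fin n) S R) (emb : B → S) :
    ∑ q : Fin m ≃ B, ∏ i : Fin m, (L * Rm) (emb (q i)) (emb (q (finRotate m i))) =
      ∑ r : B → Fin n × Fin n, (∏ s : B, L (emb s) (r s).1 * Rm (r s).2 (emb s)) *
        ∑ q : Fin m ≃ B, ∏ i : Fin m,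
          (if (r (q i)).1 = (r (q (finRotate m i))).2 then (1 : R) else 0) := by
  simp_rw [prod_mul_apply_cycle_eq_sum L Rm emb, Finset.mul_sum]
  exact Finset.sum_comm

/-! ## 2. All blocks: `v_(L R)` is a combination of count vectors -/

/-- A product over the blocks of a partition of products over the blocks' elements is the product
over everything. -/
theorem prod_parts_prod_coe_eq_prod {S R : Type*} [DecidableEq S] [Fintype S] [CommMonoid R]
    (π : Finpartition (Finset.univ : Finset S)) (f : S → R) :
    ∏ B ∈ π.parts, ∏ s : ↥B, f s = ∏ s, f s := by
  have h : ∏ B ∈ π.parts, ∏ s ∈ B, f s = ∏ s ∈ π.parts.biUnion id, f s :=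
    (Finset.prod_biUnion π.disjoint).symm
  simp_rw [Finset.prod_coe_sort] at *
  rw [h, Finpartition.biUnion_parts]

/-- **`v_(L R) = ∑_r c_r · v_(X_r)`** (row/column multilinearity of the block-cycle vectors): for
`L : S × n`, `R : n × S` and every `m`-block partition `π`,
`v_(L R)(π) = ∑_(r : S → [n]²) (∏_(s ∈ S) L_(s, r₁ s) R_(r₂ s, s)) · v_(X_r)(π)`. -/
theorem blockCycleVec_mul_eq_sum_smul {t m n : ℕ}
    (L : Matrix (Fin t × Fin m × Fin m) (Fin n) ℂ) (Rm : Matrix (Fin n) (Fin t × Fin m × Fin m) ℂ)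
    (π : {π : Finpartition (Finset.univ : Finset (Fin t × Fin m × Fin m)) //
      ∀ B ∈ π.parts, B.card = m}) :
    (∏ B ∈ π.1.parts, ∑ q : Fin m ≃ ↥B, ∏ i : Fin m, (L * Rm) (q i).1 (q (finRotate m i)).1) =
      ∑ r : Fin t × Fin m × Fin m → Fin n × Fin n,
        (∏ s, L s (r s).1 * Rm (r s).2 s) *
          ∏ B ∈ π.1.parts, ∑ q : Fin m ≃ ↥B, ∏ i : Fin m,
            (Matrix.of fun s s' : Fin t × Fin m × Fin m =>
              if (r s).1 = (r s').2 then (1 : ℂ) else 0) (q i).1 (q (finRotate m i)).1 := by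
  classical
  -- blockwise expansion
  have h1 : (∏ B ∈ π.1.parts, ∑ q : Fin m ≃ ↥B, ∏ i : Fin m, (L * Rm) (q i).1 (q (finRotate m i)).1) =
      ∏ B ∈ π.1.parts, ∑ r : ↥B → Fin n × Fin n,
        (∏ s : ↥B, L s (r s).1 * Rm (r s).2 s) *
          ∑ q : Fin m ≃ ↥B, ∏ i : Fin m,
            (if (r (q i)).1 = (r (q (finRotate m i))).2 then (1 : ℂ) else 0) :=
    Finset.prod_congr rfl fun B _ => blockCycle_mul_eq_sum L Rm (Subtype.val : ↥B → _)
  -- Fubini over the blocks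
  have hF := sum_prod_parts_eq_prod_sum π.1
    (fun (B : Finset (Fin t × Fin m × Fin m)) (r : ↥B → Fin n × Fin n) =>
      (∏ s : ↥B, L s (r s).1 * Rm (r s).2 s) *
        ∑ q : Fin m ≃ ↥B, ∏ i : Fin m,
          (if (r (q i)).1 = (r (q (finRotate m i))).2 then (1 : ℂ) else 0))
  refine h1.trans (hF.symm.trans ?_)
  refine Finset.sum_congr rfl fun r _ => ?_
  beta_reduce
  rw [Finset.prod_mul_distrib, prod_parts_prod_coe_eq_prod π.1 (fun s => L s (r s).1 * Rm (r s).2 s)]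
  rfl

/-! ## 3. The count vectors span `span_n(t,m)` -/

/-- The 0/1 slot matrix `X_r(s,s') = [r₁ s = r₂ s']` of a bi-colouring `r : S → [n]²` has rank `≤ n`. -/
theorem rank_slotIndicator_le {S : Type*} [DecidableEq S] [Fintype S] {n : ℕ}
    (r : S → Fin n × Fin n) :
    (Matrix.of fun s s' : S => if (r s).1 = (r s').2 then (1 : ℂ) else 0).rank ≤ n := by
  classical
  have hfac : (Matrix.of fun s s' : S => if (r s).1 = (r s').2 then (1 : ℂ) else 0) =
      (Matrix.of fun (s : S) (b : Fin n) => if (r s).1 = b then (1 : ℂ) else 0) *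
        (Matrix.of fun (b : Fin n) (s' : S) => if b = (r s').2 then (1 : ℂ) else 0) := by
    ext s s'
    rw [Matrix.mul_apply, Finset.sum_eq_single (r s).1]
    · simp [Matrix.of_apply]
    · intro b _ hb
      simp [Matrix.of_apply, Ne.symm hb]
    · intro h
      exact absurd (Finset.mem_univ _) h
  rw [hfac]
  refine (Matrix.rank_mul_le_left _ _).trans ?_
  exact (Matrix.rank_le_card_width _).trans (by simp)

/-- **`span_n(t,m)` is spanned by the count vectors**: the ℂ-span of the block-cycle vectors `v_X`
of all slot matrices of rank `≤ n` equals the ℂ-span of the `n^(2|S|)` count vectors `v_(X_r)`,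
`r : S → [n]²` (each `v_(X_r)(π) ∈ ℕ` counts the block-cycle systems of `π` compatible with the
bi-colouring `r`).  `⊆`: rank factorisation `X = L R` (tree `KumarVolk2020.exists_mul_eq_of_rank_le`)
and `blockCycleVec_mul_eq_sum_smul`; `⊇`: `rank_slotIndicator_le`. -/
theorem span_blockCycleVec_rank_le_eq_span_count (t m n : ℕ) :
    Submodule.span ℂ (Set.range fun X : {X : Matrix (Fin t × Fin m × Fin m)
        (Fin t × Fin m × Fin m) ℂ // X.rank ≤ n} =>
      fun π : {π : Finpartition (Finset.univ : Finset (Fin t × Fin m × Fin m)) //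
          ∀ B ∈ π.parts, B.card = m} =>
        ∏ B ∈ π.1.parts, ∑ q : Fin m ≃ ↥B, ∏ i : Fin m, X.1 (q i).1 (q (finRotate m i)).1) =
    Submodule.span ℂ (Set.range fun r : Fin t × Fin m × Fin m → Fin n × Fin n =>
      fun π : {π : Finpartition (Finset.univ : Finset (Fin t × Fin m × Fin m)) //
          ∀ B ∈ π.parts, B.card = m} =>
        ∏ B ∈ π.1.parts, ∑ q : Fin m ≃ ↥B, ∏ i : Fin m,
          (Matrix.of fun s s' : Fin t × Fin m × Fin m =>
            if (r s).1 = (r s').2 then (1 : ℂ) else 0) (q i).1 (q (finRotate m i)).1) := by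
  classical
  apply le_antisymm
  · rw [Submodule.span_le]
    rintro _ ⟨⟨X, hX⟩, rfl⟩
    obtain ⟨L, Rm, hLR⟩ := KumarVolk2020.exists_mul_eq_of_rank_le X hX
    have hfun : (fun π : {π : Finpartition (Finset.univ : Finset (Fin t × Fin m × Fin m)) //
          ∀ B ∈ π.parts, B.card = m} =>
        ∏ B ∈ π.1.parts, ∑ q : Fin m ≃ ↥B, ∏ i : Fin m, X (q i).1 (q (finRotate m i)).1) =
        ∑ r : Fin t × Fin m × Fin m → Fin n × Fin n,
          (∏ s, L s (r s).1 * Rm (r s).2 s) •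
            fun π : {π : Finpartition (Finset.univ : Finset (Fin t × Fin m × Fin m)) //
                ∀ B ∈ π.parts, B.card = m} =>
              ∏ B ∈ π.1.parts, ∑ q : Fin m ≃ ↥B, ∏ i : Fin m,
                (Matrix.of fun s s' : Fin t × Fin m × Fin m =>
                  if (r s).1 = (r s').2 then (1 : ℂ) else 0) (q i).1 (q (finRotate m i)).1 := by
      funext π
      rw [Finset.sum_apply, ← hLR, blockCycleVec_mul_eq_sum_smul L Rm π]
      refine Finset.sum_congr rfl fun r _ => ?_
      rw [Pi.smul_apply, smul_eq_mul]
    change (fun π : {π : Finpartition (Finset.univ : Finset (Fin t × Fin m × Fin m)) //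
          ∀ B ∈ π.parts, B.card = m} =>
        ∏ B ∈ π.1.parts, ∑ q : Fin m ≃ ↥B, ∏ i : Fin m, X (q i).1 (q (finRotate m i)).1) ∈ _
    rw [hfun]
    exact Submodule.sum_mem _ fun r _ => Submodule.smul_mem _ _ (Submodule.subset_span ⟨r, rfl⟩)
  · rw [Submodule.span_le]
    rintro _ ⟨r, rfl⟩
    exact Submodule.subset_span ⟨⟨_, rank_slotIndicator_le r⟩, rfl⟩

/-- **Membership transfer**: a vector lies in `span_n(t,m)` (span of the block-cycle vectors of the
rank-`≤ n` slot matrices, as in the cruxes `OneFactorisationBandLimit` / `PowTraceCertificate` /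
`BorderPcPerThree` of route SchenstedIndex) iff it lies in the span of the count vectors. -/
theorem mem_span_rank_le_iff_mem_span_count (t m n : ℕ)
    (v : {π : Finpartition (Finset.univ : Finset (Fin t × Fin m × Fin m)) //
      ∀ B ∈ π.parts, B.card = m} → ℂ) :
    v ∈ Submodule.span ℂ (Set.range fun X : {X : Matrix (Fin t × Fin m × Fin m)
        (Fin t × Fin m × Fin m) ℂ // X.rank ≤ n} =>
      fun π : {π : Finpartition (Finset.univ : Finset (Fin t × Fin m × Fin m)) //
          ∀ B ∈ π.parts, B.card = m} =>
        ∏ B ∈ π.1.parts, ∑ q : Fin m ≃ ↥B, ∏ i : Fin m, X.1 (q i).1 (q (finRotate m i)).1) ↔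
    v ∈ Submodule.span ℂ (Set.range fun r : Fin t × Fin m × Fin m → Fin n × Fin n =>
      fun π : {π : Finpartition (Finset.univ : Finset (Fin t × Fin m × Fin m)) //
          ∀ B ∈ π.parts, B.card = m} =>
        ∏ B ∈ π.1.parts, ∑ q : Fin m ≃ ↥B, ∏ i : Fin m,
          (Matrix.of fun s s' : Fin t × Fin m × Fin m =>
            if (r s).1 = (r s').2 then (1 : ℂ) else 0) (q i).1 (q (finRotate m i)).1) := by
  rw [span_blockCycleVec_rank_le_eq_span_count]

end Summit.ValiantsHypothesis.ValiantsHypothesis.Theorems.SchenstedIndex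

end
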